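import Literature.Geometry.Lorentzian.DataEmbeddingChartMetric
import Literature.Geometry.Lorentzian.IsometryProofs
import Literature.Geometry.Lorentzian.CauchyDevelopmentIsometryClasses
import Literature.Geometry.Lorentzian.HypersurfaceRestriction
import Literature.Geometry.Lorentzian.CoordSliceNormal
import Literature.Geometry.Lorentzian.TimeFunctionGradient
import HarnessLib

/-!
# A time-oriented Lorentzian metric read in a chart of the maximal atlas: the transported
# spacetime structure on the chart target, and the slicing by a coordinate time function

Companion of `DataEmbeddingChartMetric.lean` (`CoordChart.metric g hψ = Ψ^* g`, the
pseudo-Riemannian metric transported to the target of a chart `ψ` of the maximal `C^∞` atlas along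
the inverse chart `Ψ = CoordChart.inv ψ`). For a **time-oriented Lorentzian** manifold `(M, g, τ)`
the same transport gives a time-oriented Lorentzian structure on the open subset `ψ.target` of the
model space, for which `Ψ : (ψ.target, Ψ^* g, Ψ^* τ) → (M, g, τ)` is a time-orientation
preserving isometric immersion (O'Neill 1983, Ch. 3, pp. 90–91: a local diffeomorphism onto a
semi-Riemannian manifold pulls back a unique metric making it a local isometry; Ch. 5, p. 145:
time orientations pull back along local isometries):

* `CoordChart.lorentzMetric g hψ` (`= LorentzianMetric.comap` along `Ψ`; its pseudo-Riemannian
  part is `CoordChart.metric`, `lorentzMetric_toPseudoRiemannianMetric`, so all of the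
  representative API `metricRepr`, `contDiffOn_metricRepr`, `ricAt_metricRepr_eq_zero` applies),
  `CoordChart.timeOrientation g τ hψ` (`= TimeOrientation.comap`);
* `isIsometricImmersion_inv`, `preservesTimeOrientation_inv`, `isFutureDirected_iff`
  (`v` is future-directed for `Ψ^* τ` iff `dΨ v` is for `τ`), `isRicciFlat_lorentzMetric`
  (`Ric(Ψ^* g) = Ψ^* Ric(g)`, O'Neill 1983, Ch. 3, Prop. 3.59);
* **the coordinate time function.** If a linear form `ℓ` on the model space reads a function `f`
  in the chart, `ℓ (ψ x) = f x` on `ψ.source` (e.g. `ℓ = x⁰` for a chart adapted to a time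
  function `f`, `Literature/Geometry/Manifold/ChartFromFunctions.lean`), and `df` is positive on
  the future causal cone at `ψ⁻¹ p`, then `ℓ` is positive on the future causal cone of
  `(Ψ^* g, Ψ^* τ)` at `p` (`pos_of_isFutureDirected`), the inverse square lapse
  `lapseSq G ℓ p = -G_p(♯ℓ, ♯ℓ)` of the representative `G` is positive (`lapseSq_metricRepr_pos`:
  the gradient of a time function is timelike, `TimeOrientation.isTimelike_of_forall_val_pos`,
  O'Neill 1983, Ch. 5, Lemma 5.26 ff.) and the slice normal `N = -♯ℓ/√lapseSq` of the level sets
  of `ℓ` (`MetricCoord.sliceNormal`, Wald 1984, (10.2.10)) is a future-directed unit timelike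
  vector (`isFutureDirected_sliceNormal_metricRepr`);
* `TimeOrientation.transfer` — a time orientation of `g` whose vector field is timelike for a
  second Lorentzian metric `g'` on the same manifold is a time orientation of `g'`; where
  `g'_x = g_x` the two future cones coincide (`isFutureDirected_transfer_iff`).

Everything is proved; the definitions are transports/repackagings of existing structure, no
named facts (D-0026).

## References

* B. O'Neill, *Semi-Riemannian geometry with applications to relativity*, Academic Press 1983,
  Ch. 3, pp. 90–91 and Prop. 3.59; Ch. 5, Lemma 5.26 (p. 141) and p. 145. [ONeillSemiRiemannian1983]
* R. M. Wald, *General Relativity*, Chicago 1984, §10.2, (10.2.10)–(10.2.11). [Wald1984]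
-/

noncomputable section

set_option maxSynthPendingDepth 3

open Bundle Set Function Filter TopologicalSpace Manifold
open scoped Manifold ContDiff Topology

namespace Literature.Geometry.Lorentzian

/-! ### Transferring a time orientation to a second metric with the same timelike field -/

namespace TimeOrientation

variable {E : Type*} [NormedAddCommGroup E] [NormedSpace ℝ E] {H : Type*} [TopologicalSpace H]
  {I : ModelWithCorners ℝ E H} {n : ℕ∞ω} {M : Type*} [TopologicalSpace M] [ChartedSpace H M]
  [IsManifold I ∞ M] {g : LorentzianMetric I n M}

/-- **Transfer of a time orientation.** If the orienting vector field `T` of the time-oriented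
Lorentzian metric `(g, τ)` is timelike for a second Lorentzian metric `g'` of the same regularity
on `M`, then `T` is a time orientation of `g'`. Hawking–Ellis 1973, §6.1; O'Neill 1983, Ch. 5,
Lemma 5.32 (a time orientation is a continuous/smooth timelike vector field). [cite: ONeillSemiRiemannian1983, Ch. 5, Lemma 5.32 (p. 145)] -/
def transfer (τ : TimeOrientation g) (g' : LorentzianMetric I n M)
    (h : ∀ x, g'.IsTimelike (τ.vectorField x)) : TimeOrientation g' where
  vectorField := τ.vectorField
  isTimelike := h
  contMDiff := τ.contMDiff

/-- The transferred time orientation has the same vector field. [folklore] -/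
@[simp]
theorem vectorField_transfer (τ : TimeOrientation g) (g' : LorentzianMetric I n M)
    (h : ∀ x, g'.IsTimelike (τ.vectorField x)) (x : M) :
    (τ.transfer g' h).vectorField x = τ.vectorField x :=
  rfl

/-- **Where the two metrics agree, the two future cones agree**: if `g'_x = g_x` then a vector at
`x` is future-directed for `(g', T)` iff it is for `(g, T)`. [folklore] -/
theorem isFutureDirected_transfer_iff (τ : TimeOrientation g) (g' : LorentzianMetric I n M)
    (h : ∀ x, g'.IsTimelike (τ.vectorField x)) {x : M} (hx : g'.val x = g.val x)
    (v : TangentSpace I x) :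
    (τ.transfer g' h).IsFutureDirected v ↔ τ.IsFutureDirected v := by
  simp only [IsFutureDirected, LorentzianMetric.IsCausal, vectorField_transfer, hx]

end TimeOrientation

namespace CoordChart

variable {m : ℕ} {M : Type*} [TopologicalSpace M] [ChartedSpace (EuclideanSpace ℝ (Fin m)) M]
  [IsManifold (𝓡 m) ∞ M] {ψ : OpenPartialHomeomorph M (EuclideanSpace ℝ (Fin m))}
  (g : LorentzianMetric (𝓡 m) ∞ M) (τ : TimeOrientation g)

/-! ### The transported Lorentzian metric and time orientation -/

/-- **The Lorentzian metric transported to the chart target**: `Ψ^* g` on the open submanifold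
`ψ.target` of the model space, `Ψ = ψ⁻¹` the inverse chart (`LorentzianMetric.comap`; the
signature is inherited because every `dΨ_p` is a linear isometry onto `T_{Ψ p} M`). O'Neill 1983,
Ch. 3, pp. 90–91. [cite: ONeillSemiRiemannian1983, Ch. 3, pp. 90–91] -/
def lorentzMetric (hψ : ψ ∈ IsManifold.maximalAtlas (𝓡 m) ∞ M) :
    LorentzianMetric 𝓘(ℝ, EuclideanSpace ℝ (Fin m)) ∞ (target ψ) :=
  g.comap PseudoRiemannianMetric.contMDiff_pullbackBilin_holds (inv ψ) (contMDiff_inv hψ)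
    (injective_mfderiv_inv hψ) rfl

/-- The pseudo-Riemannian metric underlying the transported Lorentzian metric is the transported
pseudo-Riemannian metric `CoordChart.metric`. [folklore] -/
theorem lorentzMetric_toPseudoRiemannianMetric (hψ : ψ ∈ IsManifold.maximalAtlas (𝓡 m) ∞ M) :
    (lorentzMetric g hψ).toPseudoRiemannianMetric = metric g.toPseudoRiemannianMetric hψ :=
  rfl

/-- `(Ψ^* g)_p(a, b) = g_{Ψ p}(dΨ_p a, dΨ_p b)`. [cite: ONeillSemiRiemannian1983, Ch. 3, pp. 90–91] -/
theorem lorentzMetric_val_apply (hψ : ψ ∈ IsManifold.maximalAtlas (𝓡 m) ∞ M) (p : target ψ)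
    (a b : EuclideanSpace ℝ (Fin m)) :
    (lorentzMetric g hψ).val p a b =
      g.val (ψ.symm p) (mfderiv 𝓘(ℝ, EuclideanSpace ℝ (Fin m)) (𝓡 m) (inv ψ) p a)
        (mfderiv 𝓘(ℝ, EuclideanSpace ℝ (Fin m)) (𝓡 m) (inv ψ) p b) :=
  rfl

/-- On the target the transported Lorentzian metric is the representative `metricRepr`.
[folklore] -/
theorem lorentzMetric_val_eq_repr (hψ : ψ ∈ IsManifold.maximalAtlas (𝓡 m) ∞ M) (p : target ψ) :
    (lorentzMetric g hψ).val p = metricRepr g.toPseudoRiemannianMetric hψ p :=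
  metric_val_eq_repr g.toPseudoRiemannianMetric hψ p

/-- Applied form of `lorentzMetric_val_eq_repr`, for vectors given in the model space (the tangent
spaces of the open submanifold `ψ.target` are definitionally the model space; this form rewrites
under `E`-valued arguments). [folklore] -/
theorem lorentzMetric_val_apply_eq_repr (hψ : ψ ∈ IsManifold.maximalAtlas (𝓡 m) ∞ M)
    (p : target ψ) (u w : EuclideanSpace ℝ (Fin m)) :
    (lorentzMetric g hψ).val p u w = metricRepr g.toPseudoRiemannianMetric hψ p u w :=
  congrArg (fun B : TangentSpace 𝓘(ℝ, EuclideanSpace ℝ (Fin m)) p →L[ℝ]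
      TangentSpace 𝓘(ℝ, EuclideanSpace ℝ (Fin m)) p →L[ℝ] ℝ ↦ B u w)
    (lorentzMetric_val_eq_repr g hψ p)

/-- **The time orientation transported to the chart target**: `Ψ^* τ`, the vector field
`p ↦ (dΨ_p)⁻¹ T(Ψ p)` (`TimeOrientation.comap`). O'Neill 1983, Ch. 5, p. 145. [cite: ONeillSemiRiemannian1983, Ch. 5, p. 145] -/
def timeOrientation (hψ : ψ ∈ IsManifold.maximalAtlas (𝓡 m) ∞ M) :
    TimeOrientation (lorentzMetric g hψ) :=
  τ.comap PseudoRiemannianMetric.contMDiff_pullbackBilin_holds τ.contMDiff_comapFun_holds (inv ψ)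
    (contMDiff_inv hψ) (injective_mfderiv_inv hψ) rfl

/-- **The inverse chart is an isometric immersion** `(ψ.target, Ψ^* g) → (M, g)`. O'Neill 1983,
Ch. 3, p. 90. [cite: ONeillSemiRiemannian1983, Ch. 3, pp. 90–91] -/
theorem isIsometricImmersion_inv (hψ : ψ ∈ IsManifold.maximalAtlas (𝓡 m) ∞ M) :
    (lorentzMetric g hψ).IsIsometricImmersion g.toPseudoRiemannianMetric (inv ψ) :=
  PseudoRiemannianMetric.isIsometricImmersion_comap PseudoRiemannianMetric.contMDiff_pullbackBilin_holds
    (inv ψ) (contMDiff_inv hψ) (injective_mfderiv_inv hψ) rfl g.toPseudoRiemannianMetric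

/-- **The inverse chart preserves the time orientations** `Ψ^* τ` and `τ`. O'Neill 1983, Ch. 5,
p. 145. [cite: ONeillSemiRiemannian1983, Ch. 5, p. 145] -/
theorem preservesTimeOrientation_inv (hψ : ψ ∈ IsManifold.maximalAtlas (𝓡 m) ∞ M) :
    (timeOrientation g τ hψ).PreservesTimeOrientation (inv ψ) τ :=
  τ.preservesTimeOrientation_comap PseudoRiemannianMetric.contMDiff_pullbackBilin_holds
    τ.contMDiff_comapFun_holds (inv ψ) (contMDiff_inv hψ) (injective_mfderiv_inv hψ) rfl

/-- **Future cones correspond under the inverse chart**: `v ∈ T_p ψ.target` is future-directed for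
`(Ψ^* g, Ψ^* τ)` iff `dΨ_p v` is future-directed for `(g, τ)` (an isometric immersion preserving
the time orientation maps future cones onto future cones,
`PreservesTimeOrientation.isFutureDirected_mfderiv` / `isFutureDirected_of_mfderiv`). O'Neill 1983,
Ch. 5, Lemma 5.26 ff. and p. 145. [cite: ONeillSemiRiemannian1983, Ch. 5, p. 145] -/
theorem isFutureDirected_iff (hψ : ψ ∈ IsManifold.maximalAtlas (𝓡 m) ∞ M) {p : target ψ}
    (v : TangentSpace 𝓘(ℝ, EuclideanSpace ℝ (Fin m)) p) :
    (timeOrientation g τ hψ).IsFutureDirected v ↔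
      τ.IsFutureDirected (mfderiv 𝓘(ℝ, EuclideanSpace ℝ (Fin m)) (𝓡 m) (inv ψ) p v) :=
  ⟨fun h ↦ (preservesTimeOrientation_inv g τ hψ).isFutureDirected_mfderiv (fun _ ↦ rfl) h,
    fun h ↦ (preservesTimeOrientation_inv g τ hψ).isFutureDirected_of_mfderiv (fun _ ↦ rfl) h⟩

/-- **The transported metric of a Ricci-flat metric is Ricci-flat**: `Ric(Ψ^* g) = Ψ^* Ric(g) = 0`
(O'Neill 1983, Ch. 3, Prop. 3.59), for every proof of the standing Levi-Civita hypotheses.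
[cite: ONeillSemiRiemannian1983, Ch. 3, Prop. 3.59] -/
theorem isRicciFlat_lorentzMetric (hψ : ψ ∈ IsManifold.maximalAtlas (𝓡 m) ∞ M)
    [g.toPseudoRiemannianMetric.HasLeviCivita]
    [hLC : (lorentzMetric g hψ).toPseudoRiemannianMetric.HasLeviCivita]
    (hRic : g.toPseudoRiemannianMetric.IsRicciFlat) :
    (lorentzMetric g hψ).toPseudoRiemannianMetric.IsRicciFlat := by
  haveI hLC' : (g.toPseudoRiemannianMetric.comap PseudoRiemannianMetric.contMDiff_pullbackBilin_holds
      (inv ψ) (contMDiff_inv hψ) (injective_mfderiv_inv hψ) rfl).HasLeviCivita := hLC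
  intro p
  ext Y₀ Z₀
  have key : (lorentzMetric g hψ).toPseudoRiemannianMetric.ricci p Y₀ Z₀ =
      g.toPseudoRiemannianMetric.ricci (inv ψ p)
        (mfderiv 𝓘(ℝ, EuclideanSpace ℝ (Fin m)) (𝓡 m) (inv ψ) p Y₀)
        (mfderiv 𝓘(ℝ, EuclideanSpace ℝ (Fin m)) (𝓡 m) (inv ψ) p Z₀) :=
    PseudoRiemannianMetric.ricci_comap_apply g.toPseudoRiemannianMetric
      PseudoRiemannianMetric.contMDiff_pullbackBilin_holds (Φ := inv ψ) (contMDiff_inv hψ)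
      (injective_mfderiv_inv hψ) rfl p Y₀ Z₀
  rw [key, hRic (inv ψ p)]
  rfl

/-! ### The coordinate time function: lapse and future slice normal -/

variable {g τ}

/-- **A linear form reading a time function in the chart is positive on the transported future
cone.** If `ℓ (ψ x) = f x` on `ψ.source`, `f` is differentiable at `ψ⁻¹ p` and `df_{ψ⁻¹ p}` is
positive on the future causal cone of `(g, τ)`, then `ℓ w > 0` for every future-directed causal
`w ∈ T_p ψ.target` of `(Ψ^* g, Ψ^* τ)`: indeed `ℓ w = d(f ∘ Ψ)_p w = df(dΨ_p w)` and `dΨ_p w` is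
future-directed (`isFutureDirected_iff`). Hawking–Ellis 1973, §6.4, p. 198 (time functions).
[cite: ONeillSemiRiemannian1983, Ch. 5, p. 145] -/
theorem pos_of_isFutureDirected (hψ : ψ ∈ IsManifold.maximalAtlas (𝓡 m) ∞ M)
    {ℓ : EuclideanSpace ℝ (Fin m) →L[ℝ] ℝ} {f : M → ℝ} (hf : ∀ x ∈ ψ.source, ℓ (ψ x) = f x)
    {p : target ψ} (hfd : MDifferentiableAt (𝓡 m) 𝓘(ℝ, ℝ) f (ψ.symm p))
    (hdf : ∀ v : TangentSpace (𝓡 m) (ψ.symm p), τ.IsFutureDirected v →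
      (0 : ℝ) < mfderiv (𝓡 m) 𝓘(ℝ, ℝ) f (ψ.symm p) v)
    {w : TangentSpace 𝓘(ℝ, EuclideanSpace ℝ (Fin m)) p}
    (hw : (timeOrientation g τ hψ).IsFutureDirected w) : (0 : ℝ) < ℓ w := by
  have hfut : τ.IsFutureDirected (mfderiv 𝓘(ℝ, EuclideanSpace ℝ (Fin m)) (𝓡 m) (inv ψ) p w) :=
    (isFutureDirected_iff g τ hψ w).1 hw
  have h1 := hdf _ hfut
  -- `f ∘ Ψ = ℓ ∘ Subtype.val` on the target
  have hcomp : f ∘ inv ψ = fun q : target ψ ↦ ℓ (q : EuclideanSpace ℝ (Fin m)) := by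
    funext q
    show f (ψ.symm q) = ℓ (q : EuclideanSpace ℝ (Fin m))
    rw [← hf (ψ.symm q) (ψ.map_target q.2), ψ.right_inv q.2]
  have hinvd : MDifferentiableAt 𝓘(ℝ, EuclideanSpace ℝ (Fin m)) (𝓡 m) (inv ψ) p :=
    (contMDiff_inv' hψ).mdifferentiableAt (by simp)
  have hfd' : MDifferentiableAt (𝓡 m) 𝓘(ℝ, ℝ) f (inv ψ p) := hfd
  have hchain := mfderiv_comp p hfd' hinvd
  rw [hcomp] at hchain
  -- the differential of `q ↦ ℓ q` on the open submanifold is `ℓ`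
  have hℓ : mfderiv 𝓘(ℝ, EuclideanSpace ℝ (Fin m)) 𝓘(ℝ, ℝ)
      (fun q : target ψ ↦ ℓ (q : EuclideanSpace ℝ (Fin m))) p = ℓ := by
    have h2 : (fun q : target ψ ↦ ℓ (q : EuclideanSpace ℝ (Fin m))) =
        (ℓ : EuclideanSpace ℝ (Fin m) → ℝ) ∘ (Subtype.val : target ψ → EuclideanSpace ℝ (Fin m)) :=
      rfl
    rw [h2, mfderiv_comp p (ℓ.hasMFDerivAt.mdifferentiableAt)
      (hasMFDerivAt_subtypeVal (I' := 𝓘(ℝ, EuclideanSpace ℝ (Fin m))) p).mdifferentiableAt,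
      ContinuousLinearMap.mfderiv_eq, mfderiv_subtypeVal]
    exact ContinuousLinearMap.comp_id _
  have h3 : ℓ w = mfderiv (𝓡 m) 𝓘(ℝ, ℝ) f (inv ψ p)
      (mfderiv 𝓘(ℝ, EuclideanSpace ℝ (Fin m)) (𝓡 m) (inv ψ) p w) := by
    have h4 := DFunLike.congr_fun hchain w
    rw [hℓ] at h4
    exact h4
  rw [h3]
  exact h1

/-- **The gradient of the coordinate time is timelike: positive inverse square lapse.** Under the
hypotheses of `pos_of_isFutureDirected`, the representative `G = metricRepr g hψ` of the
transported metric has `lapseSq G ℓ p = -G_p(♯ℓ, ♯ℓ) > 0` (the vector `♯ℓ`, pairing to `ℓ w > 0`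
with every future causal `w`, is timelike: `TimeOrientation.isTimelike_of_forall_val_pos`,
O'Neill 1983, Ch. 5, Lemma 5.26 ff.; Wald 1984, (10.2.10)). [cite: Wald1984, §10.2, (10.2.10)] -/
theorem lapseSq_metricRepr_pos (hψ : ψ ∈ IsManifold.maximalAtlas (𝓡 m) ∞ M)
    {ℓ : EuclideanSpace ℝ (Fin m) →L[ℝ] ℝ} {f : M → ℝ} (hf : ∀ x ∈ ψ.source, ℓ (ψ x) = f x)
    {p : target ψ} (hfd : MDifferentiableAt (𝓡 m) 𝓘(ℝ, ℝ) f (ψ.symm p))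
    (hdf : ∀ v : TangentSpace (𝓡 m) (ψ.symm p), τ.IsFutureDirected v →
      (0 : ℝ) < mfderiv (𝓡 m) 𝓘(ℝ, ℝ) f (ψ.symm p) v) :
    0 < MetricCoord.lapseSq (metricRepr g.toPseudoRiemannianMetric hψ) ℓ p := by
  set G := metricRepr g.toPseudoRiemannianMetric hψ with hG_def
  have hG : ∀ q : target ψ, (lorentzMetric g hψ).val q = G q := lorentzMetric_val_eq_repr g hψ
  have key : ∀ u w : EuclideanSpace ℝ (Fin m), (lorentzMetric g hψ).val p u w = G p u w :=
    lorentzMetric_val_apply_eq_repr g hψ p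
  have hinv : (G p).IsInvertible := OpensChart.isInvertible_repr hG p
  rw [MetricCoord.lapseSq_pos_iff hinv]
  have hu : ∀ v : EuclideanSpace ℝ (Fin m),
      (timeOrientation g τ hψ).IsFutureDirected (x := p) v →
        0 < (lorentzMetric g hψ).val p (MetricCoord.sharpAt G p ℓ) v := fun v hv ↦ by
    rw [key, MetricCoord.apply_sharpAt_apply hinv]
    exact pos_of_isFutureDirected hψ hf hfd hdf hv
  have ht := (timeOrientation g τ hψ).isTimelike_of_forall_val_pos hu
  have ht' : (lorentzMetric g hψ).val p (MetricCoord.sharpAt G p ℓ) (MetricCoord.sharpAt G p ℓ) < 0 :=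
    ht
  rwa [key] at ht'

/-- **The slice normal of the coordinate time is the future unit normal.** Under the hypotheses
of `pos_of_isFutureDirected`, the slice normal `N_p = -♯ℓ/√lapseSq` of the level sets of `ℓ`
(`MetricCoord.sliceNormal`; Wald 1984, (10.2.10), `n^a = -α ∇^a t`) is a unit timelike vector,
`(Ψ^* g)_p(N_p, N_p) = -1`, and future-directed for `(Ψ^* g, Ψ^* τ)`: `(Ψ^* g)_p(T, N_p) =
-ℓ(T)/√lapseSq < 0` for the orienting field `T`, since `ℓ(T) > 0` (`pos_of_isFutureDirected`).
[cite: Wald1984, §10.2, (10.2.10)] -/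
theorem isFutureDirected_sliceNormal_metricRepr (hψ : ψ ∈ IsManifold.maximalAtlas (𝓡 m) ∞ M)
    {ℓ : EuclideanSpace ℝ (Fin m) →L[ℝ] ℝ} {f : M → ℝ} (hf : ∀ x ∈ ψ.source, ℓ (ψ x) = f x)
    {p : target ψ} (hfd : MDifferentiableAt (𝓡 m) 𝓘(ℝ, ℝ) f (ψ.symm p))
    (hdf : ∀ v : TangentSpace (𝓡 m) (ψ.symm p), τ.IsFutureDirected v →
      (0 : ℝ) < mfderiv (𝓡 m) 𝓘(ℝ, ℝ) f (ψ.symm p) v) :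
    (lorentzMetric g hψ).val p
        (MetricCoord.sliceNormal (metricRepr g.toPseudoRiemannianMetric hψ) ℓ p :
          EuclideanSpace ℝ (Fin m))
        (MetricCoord.sliceNormal (metricRepr g.toPseudoRiemannianMetric hψ) ℓ p :
          EuclideanSpace ℝ (Fin m)) = -1 ∧
      (timeOrientation g τ hψ).IsFutureDirected (x := p)
        (MetricCoord.sliceNormal (metricRepr g.toPseudoRiemannianMetric hψ) ℓ p :
          EuclideanSpace ℝ (Fin m)) := by
  set G := metricRepr g.toPseudoRiemannianMetric hψ with hG_def
  have hG : ∀ q : target ψ, (lorentzMetric g hψ).val q = G q := lorentzMetric_val_eq_repr g hψ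
  have key : ∀ u w : EuclideanSpace ℝ (Fin m), (lorentzMetric g hψ).val p u w = G p u w :=
    lorentzMetric_val_apply_eq_repr g hψ p
  have hinv : (G p).IsInvertible := OpensChart.isInvertible_repr hG p
  have hpos : 0 < MetricCoord.lapseSq G ℓ p := lapseSq_metricRepr_pos hψ hf hfd hdf
  set N : EuclideanSpace ℝ (Fin m) := MetricCoord.sliceNormal G ℓ p with hN
  have hunit : (lorentzMetric g hψ).val p N N = -1 := by
    rw [key]
    exact MetricCoord.apply_sliceNormal_self hinv hpos
  refine ⟨hunit, ⟨?_, ?_⟩, ?_⟩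
  · -- `G(N, N) = -1 ≤ 0`
    show (lorentzMetric g hψ).val p N N ≤ 0
    rw [hunit]
    norm_num
  · have h0 : N ≠ 0 := MetricCoord.sliceNormal_ne_zero hinv hpos
    exact h0
  · -- `G(T, N) = G(N, T) = -(√lapseSq)⁻¹ ℓ(T) < 0`, `T` being future-directed
    set T : EuclideanSpace ℝ (Fin m) := (timeOrientation g τ hψ).vectorField p with hT
    have hTfut : (timeOrientation g τ hψ).IsFutureDirected (x := p) T :=
      (timeOrientation g τ hψ).isFutureDirected_vectorField p
    have hℓT : 0 < ℓ T := pos_of_isFutureDirected hψ hf hfd hdf hTfut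
    show (lorentzMetric g hψ).val p T N < 0
    rw [(lorentzMetric g hψ).symm p, key, hN, MetricCoord.apply_sliceNormal hinv]
    have hs : 0 < (Real.sqrt (MetricCoord.lapseSq G ℓ p))⁻¹ := inv_pos.2 (Real.sqrt_pos.2 hpos)
    have := mul_pos hs hℓT
    linarith

end CoordChart

end Literature.Geometry.Lorentzian

end
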